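import Mathlib
import Literature.Analysis.FluidPDE.SuitableWeak
import Literature.Analysis.FluidPDE.SelfSimilarCollapseAnsatz
import Literature.Analysis.FluidPDE.SteadyLiouvilleTsaiPressure
import Summits.NavierStokesRegularity.NavierStokesRegularity.Theorems.EulerZoomLiouvillePowerGaugeEulerLiouvilleSelfSimilarGauges
import HarnessLib

/-!
# Rung C1 at the endpoint `ρ = 1/2`: profiles homogeneous of degree `−3/2` near infinity are
# compactly supported (Chae–Shvydkoy 2013, Thm 4.2 (iii), first half)

Route №10 `EulerZoomLiouville` (NavierStokesRegularity), crux E = stmt-NavierStokesRegularity-19832,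
tenure rung C1 (exactly self-similar members) at the endpoint `ρ = 1/2` (`α = N/2 = 3/2`).  At the
endpoint the `A`-gauge of a self-similar member says exactly `V ∈ L²(ℝ³)`
(`lintegral_enorm_sq_profile_le_of_half`).  Chae–Shvydkoy (arXiv:1201.6009, Thm 4.2 (iii)) observe
that a profile homogeneous of the natural degree `−α = −3/2` near infinity then vanishes there:
`∫_{L ≤ |y| ≤ ML} |V|² = log M · ‖W‖²_{L²(S²)}` is incompatible with `V ∈ L²` unless `W = 0`.

* `lintegral_shell_eq_of_dyadicHomogeneous` — dyadic scale invariance of the shell energies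
  `∫_{2^{k} R₀ ≤ |y| < 2^{k+1} R₀} ‖V‖²` under the (weaker, dyadic) homogeneity
  `V(2y) = 2^{−3/2} V(y)` for `|y| ≥ R₀`;
* `ae_eq_zero_tail_of_dyadicHomogeneous` — such a `V` with `∫_{|y| ≥ R₀} ‖V‖² < ∞` vanishes a.e.
  on `{|y| ≥ R₀}`;
* `selfSimilar_half_profile_compact_of_dyadicHomogeneous` — for an exactly self-similar member of
  E's class at `ρ = 1/2` (`γ = 2/5`) whose profile has a dyadically `−3/2`-homogeneous tail, the
  profile vanishes a.e. outside `B_{R₀}`: the member is spatially compactly supported.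

The second half of CS13 Thm 4.2 (iii) — a compactly supported profile is trivial — uses the
vorticity transport / Chae 2007 in the `C¹` class and is NOT available for suitable weak members;
it is recorded as the open residue of this stratum (moment identities `∫ V·y = 0`,
`∫ V ⊗ V = (‖V‖²/3) I` only constrain it).

WHAT THIS IS NOT: not NS, not E, not rung C1 — the first half of one in-window stratum at `ρ = 1/2`.
-/

noncomputable section

set_option linter.dupNamespace false

open MeasureTheory Set Filter Topology Metric Function TopologicalSpace
open scoped ENNReal NNReal InnerProductSpace RealInnerProductSpace Pointwise

namespace Summit.NavierStokesRegularity.NavierStokesRegularity.Theorems.PowerGaugeEulerLiouville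

open Literature.Analysis Literature.Analysis.FunctionSpaces Literature.Analysis.FluidPDE

section Tail

/-- The dyadic shells `S_k = {2^k R₀ ≤ |y| < 2^{k+1} R₀}`. [folklore] -/
theorem measurableSet_dyadicShell (R₀ : ℝ) (k : ℕ) :
    MeasurableSet {y : EuclideanSpace ℝ (Fin 3) | (2 : ℝ) ^ k * R₀ ≤ ‖y‖ ∧ ‖y‖ < (2 : ℝ) ^ (k + 1) * R₀} :=
  (measurableSet_le measurable_const measurable_norm).inter
    (measurableSet_lt measurable_norm measurable_const)

/-- `2 • S_k = S_{k+1}`. [folklore] -/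
theorem smul_dyadicShell (R₀ : ℝ) (k : ℕ) :
    (2 : ℝ) • {y : EuclideanSpace ℝ (Fin 3) | (2 : ℝ) ^ k * R₀ ≤ ‖y‖ ∧ ‖y‖ < (2 : ℝ) ^ (k + 1) * R₀} =
      {y : EuclideanSpace ℝ (Fin 3) | (2 : ℝ) ^ (k + 1) * R₀ ≤ ‖y‖ ∧ ‖y‖ < (2 : ℝ) ^ (k + 1 + 1) * R₀} := by
  ext y
  rw [Set.mem_smul_set_iff_inv_smul_mem₀ (two_ne_zero), mem_setOf_eq, mem_setOf_eq, norm_smul,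
    norm_inv, Real.norm_eq_abs, abs_of_pos (by norm_num : (0 : ℝ) < 2)]
  rw [pow_succ, pow_succ, pow_succ]
  constructor
  · rintro ⟨h1, h2⟩
    constructor <;> nlinarith
  · rintro ⟨h1, h2⟩
    constructor <;> nlinarith

/-- **Dyadic scale invariance of the shell energies.**  If `V(2y) = 2^{−3/2} V(y)` for `|y| ≥ R₀`
(`R₀ > 0`), then `∫_{S_{k+1}} ‖V‖² = ∫_{S_k} ‖V‖²` for every dyadic shell
`S_k = {2^k R₀ ≤ |y| < 2^{k+1} R₀}` (change of variables `y = 2y'`: `dy = 8 dy'`,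
`‖V(2y')‖² = ‖V(y')‖²/8`). [cite: ChaeShvydkoy2013, §4.1 Thm. 4.2 (iii)] -/
theorem lintegral_shell_eq_of_dyadicHomogeneous
    {V : EuclideanSpace ℝ (Fin 3) → EuclideanSpace ℝ (Fin 3)} {R₀ : ℝ} (hR₀ : 0 < R₀)
    (hhom : ∀ y : EuclideanSpace ℝ (Fin 3), R₀ ≤ ‖y‖ →
      V ((2 : ℝ) • y) = ((2 : ℝ) ^ (-(3 / 2 : ℝ))) • V y) (k : ℕ) :
    ∫⁻ y in {y : EuclideanSpace ℝ (Fin 3) | (2 : ℝ) ^ (k + 1) * R₀ ≤ ‖y‖ ∧ ‖y‖ < (2 : ℝ) ^ (k + 1 + 1) * R₀},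
        ‖V y‖ₑ ^ 2 =
      ∫⁻ y in {y : EuclideanSpace ℝ (Fin 3) | (2 : ℝ) ^ k * R₀ ≤ ‖y‖ ∧ ‖y‖ < (2 : ℝ) ^ (k + 1) * R₀},
        ‖V y‖ₑ ^ 2 := by
  have key := Tsai2021.lintegral_comp_smul_set (fun y : EuclideanSpace ℝ (Fin 3) => ‖V y‖ₑ ^ 2)
    (by norm_num : (0 : ℝ) < 2) (measurableSet_dyadicShell R₀ k)
  rw [smul_dyadicShell] at key
  -- `key : ∫⁻ x in S_k, ‖V (2 • x)‖ₑ² = ofReal ((2^3)⁻¹) * ∫⁻ x in S_{k+1}, ‖V x‖ₑ²`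
  have hhom' : ∀ y ∈ {y : EuclideanSpace ℝ (Fin 3) | (2 : ℝ) ^ k * R₀ ≤ ‖y‖ ∧ ‖y‖ < (2 : ℝ) ^ (k + 1) * R₀},
      ‖V ((2 : ℝ) • y)‖ₑ ^ 2 = ENNReal.ofReal (((2 : ℝ) ^ 3)⁻¹) * ‖V y‖ₑ ^ 2 := by
    intro y hy
    have hy' : R₀ ≤ ‖y‖ := le_trans (le_mul_of_one_le_left hR₀.le (one_le_pow₀ (by norm_num))) hy.1
    rw [hhom y hy', enorm_smul, mul_pow, Real.enorm_eq_ofReal (by positivity),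
      ← ENNReal.ofReal_pow (by positivity), ← Real.rpow_natCast, ← Real.rpow_mul (by norm_num)]
    congr 2
    norm_num
  rw [setLIntegral_congr_fun (measurableSet_dyadicShell R₀ k) hhom',
    lintegral_const_mul' _ _ ENNReal.ofReal_ne_top] at key
  have h8 : ENNReal.ofReal (((2 : ℝ) ^ 3)⁻¹) ≠ 0 := by
    rw [ENNReal.ofReal_ne_zero_iff]; positivity
  exact ((ENNReal.mul_right_inj h8 ENNReal.ofReal_ne_top).1 key).symm

/-- **A dyadically `−3/2`-homogeneous tail with finite energy vanishes.**  If
`V(2y) = 2^{−3/2} V(y)` for `|y| ≥ R₀ > 0`, `V` is a.e.-strongly measurable and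
`∫_{|y| ≥ R₀} ‖V‖² < ∞`, then `V = 0` a.e. on `{|y| ≥ R₀}`: the tail is the disjoint union of the
dyadic shells, which all carry the same energy. [cite: ChaeShvydkoy2013, §4.1 Thm. 4.2 (iii)] -/
theorem ae_eq_zero_tail_of_dyadicHomogeneous
    {V : EuclideanSpace ℝ (Fin 3) → EuclideanSpace ℝ (Fin 3)} (hVm : AEStronglyMeasurable V volume)
    {R₀ : ℝ} (hR₀ : 0 < R₀)
    (hhom : ∀ y : EuclideanSpace ℝ (Fin 3), R₀ ≤ ‖y‖ →
      V ((2 : ℝ) • y) = ((2 : ℝ) ^ (-(3 / 2 : ℝ))) • V y)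
    (hfin : ∫⁻ y in {y : EuclideanSpace ℝ (Fin 3) | R₀ ≤ ‖y‖}, ‖V y‖ₑ ^ 2 < ∞) :
    V =ᵐ[volume.restrict {y : EuclideanSpace ℝ (Fin 3) | R₀ ≤ ‖y‖}] 0 := by
  set S : ℕ → Set (EuclideanSpace ℝ (Fin 3)) := fun k =>
    {y : EuclideanSpace ℝ (Fin 3) | (2 : ℝ) ^ k * R₀ ≤ ‖y‖ ∧ ‖y‖ < (2 : ℝ) ^ (k + 1) * R₀} with hS
  have hSm : ∀ k, MeasurableSet (S k) := fun k => measurableSet_dyadicShell R₀ k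
  -- all shells carry the same energy `m`
  have hconst : ∀ k, ∫⁻ y in S k, ‖V y‖ₑ ^ 2 = ∫⁻ y in S 0, ‖V y‖ₑ ^ 2 := by
    intro k
    induction k with
    | zero => rfl
    | succ k ih => rw [← ih]; exact lintegral_shell_eq_of_dyadicHomogeneous hR₀ hhom k
  -- the tail is the disjoint union of the shells
  have hU : {y : EuclideanSpace ℝ (Fin 3) | R₀ ≤ ‖y‖} = ⋃ k, S k := by
    ext y
    simp only [mem_setOf_eq, mem_iUnion, hS]
    constructor
    · intro hy
      have hy0 : 0 < ‖y‖ := hR₀.trans_le hy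
      -- `k = ⌊log₂ (‖y‖/R₀)⌋`
      obtain ⟨k, hk1, hk2⟩ : ∃ k : ℕ, (2 : ℝ) ^ k ≤ ‖y‖ / R₀ ∧ ‖y‖ / R₀ < (2 : ℝ) ^ (k + 1) := by
        have h1 : 1 ≤ ‖y‖ / R₀ := by rw [le_div_iff₀ hR₀]; linarith
        obtain ⟨k, hk⟩ := exists_nat_pow_near h1 (by norm_num : (1 : ℝ) < 2)
        exact ⟨k, hk⟩
      refine ⟨k, ?_, ?_⟩
      · rw [le_div_iff₀ hR₀] at hk1; linarith
      · rw [div_lt_iff₀ hR₀] at hk2; linarith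
    · rintro ⟨k, hk1, -⟩
      exact le_trans (le_mul_of_one_le_left hR₀.le (one_le_pow₀ (by norm_num))) hk1
  have hdisj : Pairwise (Function.onFun Disjoint S) := by
    intro i j hij
    rw [Function.onFun, Set.disjoint_left]
    intro y hyi hyj
    simp only [hS, mem_setOf_eq] at hyi hyj
    have h2 : (1 : ℝ) < 2 := by norm_num
    rcases lt_or_gt_of_ne hij with h | h
    · have : (2 : ℝ) ^ (i + 1) * R₀ ≤ (2 : ℝ) ^ j * R₀ :=
        mul_le_mul_of_nonneg_right (pow_le_pow_right₀ h2.le (by omega)) hR₀.le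
      linarith [hyi.2, hyj.1]
    · have : (2 : ℝ) ^ (j + 1) * R₀ ≤ (2 : ℝ) ^ i * R₀ :=
        mul_le_mul_of_nonneg_right (pow_le_pow_right₀ h2.le (by omega)) hR₀.le
      linarith [hyj.2, hyi.1]
  have hsum : ∫⁻ y in {y : EuclideanSpace ℝ (Fin 3) | R₀ ≤ ‖y‖}, ‖V y‖ₑ ^ 2 =
      ∑' k : ℕ, ∫⁻ y in S 0, ‖V y‖ₑ ^ 2 := by
    rw [hU, lintegral_iUnion hSm hdisj]
    exact tsum_congr hconst
  -- hence `m = 0`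
  have hm : ∫⁻ y in S 0, ‖V y‖ₑ ^ 2 = 0 := by
    by_contra hne
    have := ENNReal.tsum_const_eq_top_of_ne_zero (α := ℕ) hne
    rw [← hsum] at this
    exact (lt_top_iff_ne_top.1 hfin) this
  have htail : ∫⁻ y in {y : EuclideanSpace ℝ (Fin 3) | R₀ ≤ ‖y‖}, ‖V y‖ₑ ^ 2 = 0 := by
    rw [hsum, hm, tsum_zero]
  have hae := (lintegral_eq_zero_iff' ((hVm.restrict).aemeasurable.enorm.pow_const 2)).1 htail
  filter_upwards [hae] with y hy
  have hy' : ‖V y‖ₑ ^ 2 = 0 := hy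
  rwa [pow_eq_zero_iff two_ne_zero, enorm_eq_zero] at hy'

/-- **C1 at `ρ = 1/2`, dyadically `−3/2`-homogeneous tails: the profile is compactly supported.**
For an exactly self-similar member of E's class at the endpoint (`γ = 1/(2 + 1/2) = 2/5`) whose
`a^{2ρ} A(a)`-gauge is bounded by `c` and whose profile satisfies `V(2y) = 2^{−3/2} V(y)` for
`|y| ≥ R₀`, the profile vanishes a.e. outside `B_{R₀}` (Chae–Shvydkoy Thm 4.2 (iii), first half,
in E's class: the `A`-gauge gives `V ∈ L²`).  The second half (compactly supported profile ⇒
trivial) is the open residue of this stratum in the suitable weak class. [cite: ChaeShvydkoy2013, §4.1 Thm. 4.2 (iii)] -/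
theorem selfSimilar_half_profile_compact_of_dyadicHomogeneous
    {u : ℝ → EuclideanSpace ℝ (Fin 3) → EuclideanSpace ℝ (Fin 3)}
    {V : EuclideanSpace ℝ (Fin 3) → EuclideanSpace ℝ (Fin 3)} {c : ℝ≥0}
    (hum : AEStronglyMeasurable (uncurry u)
      (volume.restrict (Iio (0 : ℝ) ×ˢ (univ : Set (EuclideanSpace ℝ (Fin 3))))))
    (hu : ∀ τ : ℝ, τ < 0 → u τ = selfSimilarCollapse (1 / (2 + (1 / 2 : ℝ))) 0 V τ)
    (hA : ∀ a : ℝ, 0 < a → ENNReal.ofReal (a ^ (2 * (1 / 2 : ℝ))) *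
      cknA a (0 : ℝ × EuclideanSpace ℝ (Fin 3)) u ≤ (c : ℝ≥0∞))
    {R₀ : ℝ} (hR₀ : 0 < R₀)
    (hhom : ∀ y : EuclideanSpace ℝ (Fin 3), R₀ ≤ ‖y‖ →
      V ((2 : ℝ) • y) = ((2 : ℝ) ^ (-(3 / 2 : ℝ))) • V y) :
    V =ᵐ[volume.restrict {y : EuclideanSpace ℝ (Fin 3) | R₀ ≤ ‖y‖}] 0 := by
  have hVm := aestronglyMeasurable_profile hum hu
  have hL2 := lintegral_enorm_sq_profile_le_of_half hu hA
  refine ae_eq_zero_tail_of_dyadicHomogeneous hVm hR₀ hhom ?_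
  exact lt_of_le_of_lt (setLIntegral_le_lintegral _ _) (lt_of_le_of_lt hL2 ENNReal.coe_lt_top)

end Tail

end Summit.NavierStokesRegularity.NavierStokesRegularity.Theorems.PowerGaugeEulerLiouville
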